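import Literature.NumberTheory.LFunctions.SchoenfeldPsiDifference
import Literature.NumberTheory.LFunctions.NicolasSqrtAverage
import Literature.NumberTheory.LFunctions.RosserSchoenfeldMertensFirstConstant
import HarnessLib

/-!
# Rosser–Schoenfeld 1962, Lemma 7: the tail integral `∫_x^∞ (ψ(y) − y) y⁻² dy` through the zeros of `ζ`

Topic: `Literature/NumberTheory/LFunctions`. THEOREMS (everything proved; no named fact is introduced).
Part of the discharge programme of the named fact
`Literature.NumberTheory.LFunctions.RosserSchoenfeld1962_eq_3_22` (J. B. Rosser, L. Schoenfeld,
*Approximate formulas for some functions of prime numbers*, Illinois J. Math. 6 (1962), 64–94,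
Thm. 6 (3.22): `∑_{p ≤ x} (log p)/p < log x + E + 1/(2 log x)` for `x ≥ 319`). Rosser–Schoenfeld
prove Theorems 5–6 for `x ≥ 10⁸` from the identity (4.21)
`∑_{p ≤ x} (log p)/p = log x + E + (θ(x) − x)/x − ∫_x^∞ (θ(y) − y) y⁻² dy` (the tree's
`RosserSchoenfeld1962_eq_4_21`) together with **Lemma 7** (p. 84): "For `1 < x`,
`|∫_x^∞ (y − ψ(y)) y⁻² dy| < K(1, x) + 1.84/x`", where `K` is a sum of `x^{β−1}`-weighted
reciprocal powers of the zeros `ρ = β + iγ` of `ζ` (§6, (6.1)), i.e. the explicit formula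
integrated against `y⁻²`. This file proves that lemma, in exact form, from the tree's absolutely
convergent explicit formula for `ψ₁ = ∫ψ` (`Literature.NumberTheory.LFunctions.psiOne_eq_explicit`,
`NicolasJExplicit.Rone_eq_explicit`: `ψ₁(t) − t²/2 = −Z(t) − (log 2π) t + E(t)`,
`Z(t) = ∑_ρ m(ρ) t^{ρ+1}/(ρ(ρ+1))`, `Re E` non-decreasing with
`0 ≤ Re E(y) − Re E(x) ≤ x/(2(x² − 1))`):

* `integral_psi_sub_self_div_sq_Icc` — integration by parts, `1 < x ≤ Y`:
  `∫_x^Y (ψ(t) − t) t⁻² dt = R₁(Y)/Y² − R₁(x)/x² + 2 ∫_x^Y R₁(t) t⁻³ dt`, `R₁ = ψ₁ − t²/2`;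
* `hasSum_tailZeroTerm_sub` — the zeros' part: for `1 ≤ x ≤ Y`,
  `Z(Y)/Y² − Z(x)/x² + 2∫_x^Y Z(t) t⁻³ dt = ∑_ρ m(ρ)(Y^{ρ−1} − x^{ρ−1})/(ρ(ρ−1))`
  (termwise, `∫_x^Y t^{ρ−2} dt = (Y^{ρ−1} − x^{ρ−1})/(ρ − 1)`; dominated convergence on `[x, Y]`);
* `integral_psi_sub_self_div_sq_eq` — for `1 < x ≤ Y`:
  `∫_x^Y (ψ(t) − t) t⁻² dt = −Re ∑_ρ m(ρ)(Y^{ρ−1} − x^{ρ−1})/(ρ(ρ−1)) − log(2π)(1/x − 1/Y) + e(x, Y)`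
  with `0 ≤ e(x, Y) ≤ 1/(2x(x² − 1))` (`eRem_nonneg`, `eRem_le`);
* `tendsto_tsum_tailZeroTerm` — `∑_ρ m(ρ) Y^{ρ−1}/(ρ(ρ−1)) → 0` as `Y → ∞` (every `β < 1`,
  dominated by `∑ m(ρ)/(|ρ||ρ−1|) < ∞`, `summable_norm_tailZeroTerm`);
* **`integral_Ioi_psi_sub_self_div_sq_eq`** (Lemma 7, exact form) — for `x > 1`,
  `∫_x^∞ (ψ(t) − t) t⁻² dt = Re ∑_ρ m(ρ) x^{ρ−1}/(ρ(ρ−1)) − log(2π)/x + e(x)`,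
  `0 ≤ e(x) ≤ 1/(2x(x² − 1))` (`eInf_nonneg`, `eInf_le`); hence
  **`abs_integral_Ioi_psi_sub_self_div_sq_le`**:
  `|∫_x^∞ (ψ(t) − t) t⁻² dt| ≤ K(x) + log(2π)/x + 1/(2x(x² − 1))`,
  `K(x) = ∑_ρ m(ρ) x^{β−1}/(|ρ||ρ−1|)` (`rsK`), Rosser–Schoenfeld's shape (`log 2π = 1.8378…`);
* `rsK_le_of_inStripUpTo` — under RH up to height `T` (`RiemannHypothesisInStripUpTo T`, e.g.
  `platt_trudgian_numerical_rh` for `T = 3 000 175 332 800`), for `x ≥ 1`: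
  `K(x) ≤ x^{−1/2} · ∑_{|Im ρ| ≤ T} m(ρ)/|ρ|² + ∑_{|Im ρ| > T} m(ρ)/(|ρ||ρ−1|)`
  (`SchoenfeldBound.sumInvNormSq T` and the tail `tailInvNormProd T`; on the line `|ρ − 1| = |ρ|`).

The explicit numerical bound of the tail `∑_{|Im ρ| > T} m(ρ)/(|ρ||ρ−1|)` through `N(T)` is not
part of this file.

## References

* J. B. Rosser, L. Schoenfeld, Illinois J. Math. 6 (1962), 64–94: Lemma 7 (p. 84), (4.21), §6 (6.1),
  proof of Thms. 5–6 (p. 87). [RosserSchoenfeld1962]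
* H. L. Montgomery, R. C. Vaughan, *Multiplicative Number Theory I*, CUP 2007, (13.7) and §12.1.1
  Exercise 6 (the explicit formula for `ψ₁`). [MontgomeryVaughan2007]
-/

noncomputable section

open Complex Filter Set MeasureTheory Topology intervalIntegral
open scoped Real Chebyshev

namespace Literature.NumberTheory.LFunctions

namespace PsiTailIntegral

open NicolasJExplicit NicolasJ SchoenfeldBound
open NicolasSqrtAverage (Rone_eq_re)

/-! ### Basic facts on the zeros -/

/-- `ρ − 1 ≠ 0` for a non-trivial zero. [folklore] -/
theorem sub_one_ne_zero (ρ : Zeros) : (ρ : ℂ) - 1 ≠ 0 :=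
  sub_ne_zero.2 (ZetaZeros.riemannZetaNontrivialZeros.ne_one ρ.2)

/-- `|Im ρ| ≤ ‖ρ − 1‖`. [folklore] -/
theorem abs_im_le_norm_sub_one (ρ : Zeros) : |(ρ : ℂ).im| ≤ ‖(ρ : ℂ) - 1‖ := by
  have h := Complex.abs_im_le_norm ((ρ : ℂ) - 1)
  simpa using h

/-- `‖ρ + 1‖ ≤ |Im ρ| + 2`. [folklore] -/
theorem norm_add_one_le (ρ : Zeros) : ‖(ρ : ℂ) + 1‖ ≤ |(ρ : ℂ).im| + 2 := by
  have h1 := Complex.norm_le_abs_re_add_abs_im ((ρ : ℂ) + 1)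
  have hre0 := re_pos ρ.2
  have hre1 := re_lt_one ρ.2
  have h2 : |((ρ : ℂ) + 1).re| ≤ 2 := by
    rw [add_re, one_re, abs_of_pos (by linarith)]; linarith
  have h3 : ((ρ : ℂ) + 1).im = (ρ : ℂ).im := by simp
  rw [h3] at h1
  linarith

/-- **`‖ρ + 1‖ ≤ C ‖ρ − 1‖` uniformly over the non-trivial zeros**, for some `C > 0`: the zeros with
`|Im ρ| ≤ 1` form a finite set on which `‖ρ − 1‖ > 0`, and for `|Im ρ| > 1` one has
`‖ρ + 1‖ ≤ |Im ρ| + 2 < 3|Im ρ| ≤ 3‖ρ − 1‖`. [folklore] -/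
theorem exists_norm_add_one_le_mul_norm_sub_one :
    ∃ C : ℝ, 0 < C ∧ ∀ ρ : Zeros, ‖(ρ : ℂ) + 1‖ ≤ C * ‖(ρ : ℂ) - 1‖ := by
  classical
  set S := zerosUpTo 1 with hS
  set C₀ : ℝ := ∑ ρ ∈ S, ‖(ρ : ℂ) + 1‖ / ‖(ρ : ℂ) - 1‖ with hC₀
  have hC₀0 : 0 ≤ C₀ := Finset.sum_nonneg fun ρ _ ↦ div_nonneg (norm_nonneg _) (norm_nonneg _)
  refine ⟨C₀ + 3, by linarith, fun ρ ↦ ?_⟩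
  have hpos : 0 < ‖(ρ : ℂ) - 1‖ := norm_pos_iff.2 (sub_one_ne_zero ρ)
  by_cases hρ : ρ ∈ S
  · have h1 : ‖(ρ : ℂ) + 1‖ / ‖(ρ : ℂ) - 1‖ ≤ C₀ :=
      Finset.single_le_sum (f := fun ρ : Zeros ↦ ‖(ρ : ℂ) + 1‖ / ‖(ρ : ℂ) - 1‖)
        (fun ρ _ ↦ div_nonneg (norm_nonneg _) (norm_nonneg _)) hρ
    rw [div_le_iff₀ hpos] at h1
    nlinarith
  · have hT : 1 < |(ρ : ℂ).im| := by
      have := (mem_zerosUpTo (T := 1) (ρ := ρ)).not.1 hρ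
      exact lt_of_not_ge this
    have h1 := norm_add_one_le ρ
    have h2 := abs_im_le_norm_sub_one ρ
    nlinarith

/-! ### The term `m(ρ) x^{ρ−1}/(ρ(ρ−1))` and the sum `K(x)` -/

/-- The `ρ`-th term of the integrated explicit formula: `m(ρ) x^{ρ−1}/(ρ(ρ−1))`.
[cite: RosserSchoenfeld1962, Lemma 7 and (6.1)] -/
def tailZeroTerm (ρ : Zeros) (x : ℝ) : ℂ :=
  (riemannZetaZeroOrder (ρ : ℂ) : ℂ) * ((x : ℂ) ^ ((ρ : ℂ) - 1) / ((ρ : ℂ) * ((ρ : ℂ) - 1)))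

/-- `‖m(ρ) x^{ρ−1}/(ρ(ρ−1))‖ = m(ρ) x^{β−1}/(|ρ||ρ−1|)` for `x > 0`. [folklore] -/
theorem norm_tailZeroTerm {x : ℝ} (hx : 0 < x) (ρ : Zeros) :
    ‖tailZeroTerm ρ x‖ = (riemannZetaZeroOrder (ρ : ℂ) : ℝ) * x ^ ((ρ : ℂ).re - 1) /
      (‖(ρ : ℂ)‖ * ‖(ρ : ℂ) - 1‖) := by
  rw [tailZeroTerm, norm_mul, Complex.norm_intCast, abs_of_nonneg (zeroOrder_nonneg' ρ), norm_div,
    norm_mul, Complex.norm_cpow_eq_rpow_re_of_pos hx, sub_re, one_re, mul_div_assoc]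

/-- `‖m(ρ) x^{ρ−1}/(ρ(ρ−1))‖ ≤ m(ρ)/(|ρ||ρ−1|)` for `x ≥ 1` (`β < 1`). [folklore] -/
theorem norm_tailZeroTerm_le {x : ℝ} (hx : 1 ≤ x) (ρ : Zeros) :
    ‖tailZeroTerm ρ x‖ ≤ (riemannZetaZeroOrder (ρ : ℂ) : ℝ) / (‖(ρ : ℂ)‖ * ‖(ρ : ℂ) - 1‖) := by
  rw [norm_tailZeroTerm (by linarith) ρ]
  have hm := zeroOrder_nonneg' ρ
  have hden : 0 < ‖(ρ : ℂ)‖ * ‖(ρ : ℂ) - 1‖ :=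
    mul_pos (norm_pos ρ) (norm_pos_iff.2 (sub_one_ne_zero ρ))
  refine div_le_div_of_nonneg_right ?_ hden.le
  have h1 : x ^ ((ρ : ℂ).re - 1) ≤ 1 :=
    Real.rpow_le_one_of_one_le_of_nonpos hx (by linarith [re_lt_one ρ.2])
  nlinarith

/-- **`∑_ρ m(ρ)/(|ρ||ρ−1|) < ∞`** (from the absolute convergence of the explicit formula for `ψ₁`
at `t = 1`, `∑_ρ m(ρ)/|ρ(ρ+1)| < ∞`, and `‖ρ+1‖ ≤ C‖ρ−1‖`). [cite: MontgomeryVaughan2007, (13.7)] -/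
theorem summable_zeroOrder_div_norm_mul_norm_sub_one :
    Summable fun ρ : Zeros ↦ (riemannZetaZeroOrder (ρ : ℂ) : ℝ) / (‖(ρ : ℂ)‖ * ‖(ρ : ℂ) - 1‖) := by
  obtain ⟨C, hC0, hC⟩ := exists_norm_add_one_le_mul_norm_sub_one
  have hs : Summable fun ρ : Zeros ↦ C * ‖zeroTerm ρ 1‖ :=
    (summable_norm_psiOne_zeroTerm le_rfl).mul_left C
  refine Summable.of_nonneg_of_le (fun ρ ↦ div_nonneg (zeroOrder_nonneg' ρ)
    (mul_nonneg (norm_nonneg _) (norm_nonneg _))) (fun ρ ↦ ?_) hs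
  have hm := zeroOrder_nonneg' ρ
  have h0 := norm_pos ρ
  have h1 : 0 < ‖(ρ : ℂ) - 1‖ := norm_pos_iff.2 (sub_one_ne_zero ρ)
  have h2 : 0 < ‖(ρ : ℂ) + 1‖ := norm_pos_iff.2 (add_one_ne_zero ρ.2)
  have heq : ‖zeroTerm ρ 1‖ = (riemannZetaZeroOrder (ρ : ℂ) : ℝ) / (‖(ρ : ℂ)‖ * ‖(ρ : ℂ) + 1‖) := by
    rw [zeroTerm, norm_mul, Complex.norm_intCast, abs_of_nonneg hm, norm_div, norm_mul,
      Complex.ofReal_one, Complex.one_cpow, norm_one, ← div_eq_mul_one_div]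
  rw [heq, div_le_iff₀ (mul_pos h0 h1)]
  have key : C * ((riemannZetaZeroOrder (ρ : ℂ) : ℝ) / (‖(ρ : ℂ)‖ * ‖(ρ : ℂ) + 1‖)) *
      (‖(ρ : ℂ)‖ * ‖(ρ : ℂ) - 1‖) =
      (riemannZetaZeroOrder (ρ : ℂ) : ℝ) * (C * ‖(ρ : ℂ) - 1‖ / ‖(ρ : ℂ) + 1‖) := by
    field_simp
  rw [key]
  have h4 : 1 ≤ C * ‖(ρ : ℂ) - 1‖ / ‖(ρ : ℂ) + 1‖ := by
    rw [le_div_iff₀ h2, one_mul]; exact hC ρ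
  nlinarith

/-- `∑_ρ ‖m(ρ) x^{ρ−1}/(ρ(ρ−1))‖ < ∞` for `x ≥ 1`. [folklore] -/
theorem summable_norm_tailZeroTerm {x : ℝ} (hx : 1 ≤ x) : Summable fun ρ : Zeros ↦ ‖tailZeroTerm ρ x‖ :=
  Summable.of_nonneg_of_le (fun _ ↦ norm_nonneg _) (norm_tailZeroTerm_le hx)
    summable_zeroOrder_div_norm_mul_norm_sub_one

/-- `∑_ρ m(ρ) x^{ρ−1}/(ρ(ρ−1))` converges (absolutely) for `x ≥ 1`. [folklore] -/
theorem summable_tailZeroTerm {x : ℝ} (hx : 1 ≤ x) : Summable fun ρ : Zeros ↦ tailZeroTerm ρ x :=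
  (summable_norm_tailZeroTerm hx).of_norm

/-- Rosser–Schoenfeld's `K`: `K(x) = ∑_ρ m(ρ) x^{β−1}/(|ρ||ρ−1|)` (the sum of the moduli of the
terms of the integrated explicit formula). [cite: RosserSchoenfeld1962, Lemma 7 and (6.1)] -/
def rsK (x : ℝ) : ℝ := ∑' ρ : Zeros, ‖tailZeroTerm ρ x‖

/-- `K(x) ≥ 0`. [folklore] -/
theorem rsK_nonneg (x : ℝ) : 0 ≤ rsK x := tsum_nonneg fun _ ↦ norm_nonneg _

/-- `|Re ∑_ρ m(ρ) x^{ρ−1}/(ρ(ρ−1))| ≤ K(x)` (`x ≥ 1`). [folklore] -/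
theorem abs_re_tsum_tailZeroTerm_le {x : ℝ} (hx : 1 ≤ x) :
    |(∑' ρ : Zeros, tailZeroTerm ρ x).re| ≤ rsK x :=
  (Complex.abs_re_le_norm _).trans (norm_tsum_le_tsum_norm (summable_norm_tailZeroTerm hx))


/-! ### Integration by parts: `∫_x^Y (ψ − t) t⁻² = [R₁ t⁻²]_x^Y + 2∫_x^Y R₁ t⁻³` -/

/-- **Integration by parts**: for `1 < x ≤ Y`,
`∫_x^Y (ψ(t) − t) t⁻² dt = R₁(Y)/Y² − R₁(x)/x² + 2∫_x^Y R₁(t) t⁻³ dt` (`R₁ = ψ₁ − t²/2`, whose right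
derivative is `ψ − t`). [cite: RosserSchoenfeld1962, Lemma 7 (proof)] -/
theorem integral_psi_sub_self_div_sq_Icc {x Y : ℝ} (hx : 1 < x) (hxY : x ≤ Y) :
    ∫ t in x..Y, (ψ t - t) / t ^ 2 =
      Rone Y / Y ^ 2 - Rone x / x ^ 2 + 2 * ∫ t in x..Y, Rone t / t ^ 3 := by
  -- `d/dt (t²)⁻¹ = −2/t³`
  have hd : ∀ {t : ℝ}, t ≠ 0 → HasDerivAt (fun u : ℝ ↦ (u ^ 2)⁻¹) (-2 / t ^ 3) t := by
    intro t ht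
    refine ((hasDerivAt_pow 2 t).inv (pow_ne_zero 2 ht)).congr_deriv ?_
    rw [div_eq_div_iff (pow_ne_zero 2 (pow_ne_zero 2 ht)) (pow_ne_zero 3 ht)]
    push_cast
    ring
  have hIcc : uIcc x Y = Icc x Y := uIcc_of_le hxY
  have hv : ContinuousOn (fun t : ℝ ↦ (t ^ 2)⁻¹) (uIcc x Y) := by
    rw [hIcc]
    exact (continuousOn_pow 2).inv₀ fun t ht ↦ pow_ne_zero _ (by linarith [ht.1])
  have hv' : ContinuousOn (fun t : ℝ ↦ -2 / t ^ 3) (uIcc x Y) := by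
    rw [hIcc]
    exact continuousOn_const.div (continuousOn_pow 3) fun t ht ↦ pow_ne_zero _ (by linarith [ht.1])
  have h := integral_deriv_mul_eq_sub_of_hasDeriv_right (u := Rone) (v := fun t : ℝ ↦ (t ^ 2)⁻¹)
    (u' := fun t ↦ ψ t - t) (v' := fun t ↦ -2 / t ^ 3) (a := x) (b := Y)
    continuous_Rone.continuousOn hv (fun t _ ↦ hasDerivWithinAt_Rone t)
    (fun t ht ↦ (hd (by rw [min_eq_left hxY] at ht; linarith [ht.1])).hasDerivWithinAt)
    ((intervalIntegrable_psi x Y).sub intervalIntegrable_id) hv'.intervalIntegrable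
  have hi1 : IntervalIntegrable (fun t ↦ (ψ t - t) * (t ^ 2)⁻¹) volume x Y :=
    ((intervalIntegrable_psi x Y).sub intervalIntegrable_id).mul_continuousOn hv
  have hi2 : IntervalIntegrable (fun t ↦ Rone t * (-2 / t ^ 3)) volume x Y :=
    hv'.intervalIntegrable.continuousOn_mul continuous_Rone.continuousOn
  rw [integral_add hi1 hi2] at h
  have e1 : ∫ t in x..Y, (ψ t - t) / t ^ 2 = ∫ t in x..Y, (ψ t - t) * (t ^ 2)⁻¹ :=
    integral_congr fun t _ ↦ by simp only [div_eq_mul_inv]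
  have e2 : ∫ t in x..Y, Rone t * (-2 / t ^ 3) = -2 * ∫ t in x..Y, Rone t / t ^ 3 := by
    rw [← intervalIntegral.integral_const_mul]
    exact integral_congr fun t _ ↦ by ring
  rw [e1]
  rw [e2] at h
  have e3 : Rone Y / Y ^ 2 = Rone Y * (Y ^ 2)⁻¹ := div_eq_mul_inv _ _
  have e4 : Rone x / x ^ 2 = Rone x * (x ^ 2)⁻¹ := div_eq_mul_inv _ _
  rw [e3, e4]
  linear_combination h

/-! ### The zeros' part, one zero at a time -/

/-- `t^{ρ+1} = t^{ρ−1} t²` (`t > 0`). [folklore] -/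
theorem cpow_add_one_eq_mul_sq {t : ℝ} (ht : 0 < t) (ρ : ℂ) :
    (t : ℂ) ^ (ρ + 1) = (t : ℂ) ^ (ρ - 1) * (t : ℂ) ^ 2 := by
  have ht0 : (t : ℂ) ≠ 0 := Complex.ofReal_ne_zero.2 ht.ne'
  rw [show ρ + 1 = (ρ - 1) + 2 by ring, Complex.cpow_add _ _ ht0,
    show (2 : ℂ) = ((2 : ℕ) : ℂ) by norm_cast, Complex.cpow_natCast]

/-- `t^{ρ+1} = t^{ρ−2} t³` (`t > 0`). [folklore] -/
theorem cpow_add_one_eq_mul_cube {t : ℝ} (ht : 0 < t) (ρ : ℂ) :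
    (t : ℂ) ^ (ρ + 1) = (t : ℂ) ^ (ρ - 2) * (t : ℂ) ^ 3 := by
  have ht0 : (t : ℂ) ≠ 0 := Complex.ofReal_ne_zero.2 ht.ne'
  rw [show ρ + 1 = (ρ - 2) + 3 by ring, Complex.cpow_add _ _ ht0,
    show (3 : ℂ) = ((3 : ℕ) : ℂ) by norm_cast, Complex.cpow_natCast]

/-- `zeroTerm ρ t / t² = m(ρ) t^{ρ−1}/(ρ(ρ+1))` (`t > 0`). [folklore] -/
theorem zeroTerm_div_sq {t : ℝ} (ht : 0 < t) (ρ : Zeros) :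
    zeroTerm ρ t / (t : ℂ) ^ 2 =
      (riemannZetaZeroOrder (ρ : ℂ) : ℂ) * ((t : ℂ) ^ ((ρ : ℂ) - 1) / ((ρ : ℂ) * (ρ + 1))) := by
  have ht1 : (t : ℂ) ≠ 0 := Complex.ofReal_ne_zero.2 ht.ne'
  have ht0 : (t : ℂ) ^ 2 ≠ 0 := pow_ne_zero _ ht1
  have h0 := ne_zero ρ.2
  have h1 := add_one_ne_zero ρ.2
  rw [zeroTerm, cpow_add_one_eq_mul_sq ht]
  field_simp

/-- `zeroTerm ρ t / t³ = (m(ρ)/(ρ(ρ+1))) t^{ρ−2}` (`t > 0`). [folklore] -/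
theorem zeroTerm_div_cube {t : ℝ} (ht : 0 < t) (ρ : Zeros) :
    zeroTerm ρ t / (t : ℂ) ^ 3 =
      (riemannZetaZeroOrder (ρ : ℂ) : ℂ) / ((ρ : ℂ) * (ρ + 1)) * (t : ℂ) ^ ((ρ : ℂ) - 2) := by
  have ht1 : (t : ℂ) ≠ 0 := Complex.ofReal_ne_zero.2 ht.ne'
  have ht0 : (t : ℂ) ^ 3 ≠ 0 := pow_ne_zero _ ht1
  have h0 := ne_zero ρ.2
  have h1 := add_one_ne_zero ρ.2
  rw [zeroTerm, cpow_add_one_eq_mul_cube ht]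
  field_simp

/-- `∫_x^Y t^{ρ−2} dt = (Y^{ρ−1} − x^{ρ−1})/(ρ − 1)` for `0 < x ≤ Y` (`ρ ≠ 1`). [folklore] -/
theorem integral_cpow_sub_two {x Y : ℝ} (hx : 0 < x) (hxY : x ≤ Y) (ρ : Zeros) :
    ∫ t in x..Y, (t : ℂ) ^ ((ρ : ℂ) - 2) =
      ((Y : ℂ) ^ ((ρ : ℂ) - 1) - (x : ℂ) ^ ((ρ : ℂ) - 1)) / ((ρ : ℂ) - 1) := by
  have hr : (ρ : ℂ) - 2 ≠ -1 := by
    intro h1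
    exact sub_one_ne_zero ρ (by linear_combination h1)
  have h0 : (0 : ℝ) ∉ uIcc x Y := by
    rw [uIcc_of_le hxY]
    exact fun h ↦ by linarith [h.1]
  have h := integral_cpow (a := x) (b := Y) (r := (ρ : ℂ) - 2) (Or.inr ⟨hr, h0⟩)
  rw [show (ρ : ℂ) - 2 + 1 = (ρ : ℂ) - 1 by ring] at h
  exact h

/-- **One zero**: for `0 < x ≤ Y`,
`zeroTerm ρ Y/Y² − zeroTerm ρ x/x² + 2∫_x^Y zeroTerm ρ t t⁻³ dt = m(ρ)(Y^{ρ−1} − x^{ρ−1})/(ρ(ρ−1))`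
(`1/(ρ(ρ+1)) · (1 + 2/(ρ−1)) = 1/(ρ(ρ−1))`). [cite: RosserSchoenfeld1962, Lemma 7 (proof)] -/
theorem zero_bracket {x Y : ℝ} (hx : 0 < x) (hxY : x ≤ Y) (ρ : Zeros) :
    zeroTerm ρ Y / (Y : ℂ) ^ 2 - zeroTerm ρ x / (x : ℂ) ^ 2 +
      2 * ∫ t in x..Y, zeroTerm ρ t / (t : ℂ) ^ 3 = tailZeroTerm ρ Y - tailZeroTerm ρ x := by
  have hY : 0 < Y := hx.trans_le hxY
  have hint : ∫ t in x..Y, zeroTerm ρ t / (t : ℂ) ^ 3 =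
      (riemannZetaZeroOrder (ρ : ℂ) : ℂ) / ((ρ : ℂ) * (ρ + 1)) *
        (((Y : ℂ) ^ ((ρ : ℂ) - 1) - (x : ℂ) ^ ((ρ : ℂ) - 1)) / ((ρ : ℂ) - 1)) := by
    rw [← integral_cpow_sub_two hx hxY ρ, ← intervalIntegral.integral_const_mul]
    refine integral_congr fun t ht ↦ ?_
    rw [uIcc_of_le hxY] at ht
    exact zeroTerm_div_cube (hx.trans_le ht.1) ρ
  rw [hint, zeroTerm_div_sq hY, zeroTerm_div_sq hx, tailZeroTerm, tailZeroTerm]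
  have h0 := ne_zero ρ.2
  have h1 := add_one_ne_zero ρ.2
  have h2 := sub_one_ne_zero ρ
  field_simp
  ring

/-! ### The zeros' part, summed: dominated convergence on `[x, Y]` -/

/-- `zeroTerm ρ · / t³` is continuous on `[x, Y]` (`x > 0`). [folklore] -/
theorem continuousOn_zeroTerm_div_cube {x Y : ℝ} (hx : 0 < x) (ρ : Zeros) :
    ContinuousOn (fun t : ℝ ↦ zeroTerm ρ t / (t : ℂ) ^ 3) (Icc x Y) := by
  have hc : Continuous fun t : ℝ ↦ (t : ℂ) ^ ((ρ : ℂ) + 1) :=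
    continuous_ofReal_cpow_const (by rw [add_re, one_re]; linarith [re_pos ρ.2])
  have hz : Continuous fun t : ℝ ↦ zeroTerm ρ t := continuous_const.mul (hc.div_const _)
  refine hz.continuousOn.div (Continuous.continuousOn (by fun_prop)) fun t ht ↦ ?_
  exact pow_ne_zero _ (Complex.ofReal_ne_zero.2 (by linarith [ht.1]))

/-- `zeroTerm ρ · / t³` is integrable on `(x, Y]` (`x > 0`). [folklore] -/
theorem integrableOn_zeroTerm_div_cube {x Y : ℝ} (hx : 0 < x) (ρ : Zeros) :
    IntegrableOn (fun t : ℝ ↦ zeroTerm ρ t / (t : ℂ) ^ 3) (Ioc x Y) :=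
  ((continuousOn_zeroTerm_div_cube (Y := Y) hx ρ).integrableOn_Icc).mono_set Ioc_subset_Icc_self

/-- On `(x, Y]`, `x ≥ 1`: `‖zeroTerm ρ t / t³‖ ≤ Y² ‖zeroTerm ρ 1‖`. [folklore] -/
theorem norm_zeroTerm_div_cube_le {x Y t : ℝ} (hx : 1 ≤ x) (ht : t ∈ Ioc x Y) (ρ : Zeros) :
    ‖zeroTerm ρ t / (t : ℂ) ^ 3‖ ≤ Y ^ 2 * ‖zeroTerm ρ 1‖ := by
  have ht1 : 1 ≤ t := hx.trans ht.1.le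
  have ht0 : 0 < t := by linarith
  have h1 := norm_zeroTerm_le_sq_mul ρ (X := Y) (t := t) ⟨ht1, ht.2⟩
  rw [norm_div, norm_pow, Complex.norm_real, Real.norm_eq_abs, abs_of_pos ht0]
  have ht3 : 1 ≤ t ^ 3 := one_le_pow₀ ht1
  calc ‖zeroTerm ρ t‖ / t ^ 3 ≤ ‖zeroTerm ρ t‖ := div_le_self (norm_nonneg _) ht3
    _ ≤ Y ^ 2 * ‖zeroTerm ρ 1‖ := h1

/-- `∫_{(x,Y]} ‖zeroTerm ρ t / t³‖ ≤ (Y − x) Y² ‖zeroTerm ρ 1‖` (`1 ≤ x ≤ Y`). [folklore] -/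
theorem integral_norm_zeroTerm_div_cube_le {x Y : ℝ} (hx : 1 ≤ x) (hxY : x ≤ Y) (ρ : Zeros) :
    ∫ t in Ioc x Y, ‖zeroTerm ρ t / (t : ℂ) ^ 3‖ ≤ (Y - x) * (Y ^ 2 * ‖zeroTerm ρ 1‖) := by
  have hx0 : 0 < x := by linarith
  calc ∫ t in Ioc x Y, ‖zeroTerm ρ t / (t : ℂ) ^ 3‖ ≤ ∫ t in Ioc x Y, Y ^ 2 * ‖zeroTerm ρ 1‖ := by
        refine setIntegral_mono_on (integrableOn_zeroTerm_div_cube hx0 ρ).norm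
          (integrableOn_const (by simp)) measurableSet_Ioc fun t ht ↦ ?_
        exact norm_zeroTerm_div_cube_le hx ht ρ
    _ = (Y - x) * (Y ^ 2 * ‖zeroTerm ρ 1‖) := by
        rw [setIntegral_const, Real.volume_real_Ioc_of_le hxY, smul_eq_mul]

/-- **`∫_x^Y Z(t) t⁻³ dt = ∑_ρ ∫_x^Y zeroTerm ρ t t⁻³ dt`**, the series of integrals converging
(absolutely), for `1 ≤ x ≤ Y`. [folklore] -/
theorem integral_Zsum_div_cube {x Y : ℝ} (hx : 1 ≤ x) (hxY : x ≤ Y) :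
    (∫ t in x..Y, Zsum t / (t : ℂ) ^ 3 = ∑' ρ : Zeros, ∫ t in x..Y, zeroTerm ρ t / (t : ℂ) ^ 3) ∧
    Summable fun ρ : Zeros ↦ ∫ t in x..Y, zeroTerm ρ t / (t : ℂ) ^ 3 := by
  have hx0 : 0 < x := by linarith
  have hbound : Summable fun ρ : Zeros ↦ (Y - x) * (Y ^ 2 * ‖zeroTerm ρ 1‖) :=
    ((summable_norm_psiOne_zeroTerm le_rfl).mul_left (Y ^ 2)).mul_left (Y - x)
  have hnorm : Summable fun ρ : Zeros ↦ ∫ t in Ioc x Y, ‖zeroTerm ρ t / (t : ℂ) ^ 3‖ :=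
    Summable.of_nonneg_of_le (fun ρ ↦ integral_nonneg fun t ↦ norm_nonneg _)
      (fun ρ ↦ integral_norm_zeroTerm_div_cube_le hx hxY ρ) hbound
  have h := integral_tsum_of_summable_integral_norm (μ := volume.restrict (Ioc x Y))
    (F := fun (ρ : Zeros) (t : ℝ) ↦ zeroTerm ρ t / (t : ℂ) ^ 3)
    (fun ρ ↦ integrableOn_zeroTerm_div_cube hx0 ρ) hnorm
  simp_rw [intervalIntegral.integral_of_le hxY]
  constructor
  · rw [h]
    refine integral_congr_ae (ae_of_all _ fun t ↦ ?_)
    simp only [Zsum, div_eq_mul_inv]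
    exact tsum_mul_right.symm
  · refine Summable.of_norm_bounded hnorm fun ρ ↦ ?_
    exact norm_integral_le_integral_norm _

/-- **The zeros' part of Lemma 7, summed**: for `1 ≤ x ≤ Y`,
`∑_ρ m(ρ)(Y^{ρ−1} − x^{ρ−1})/(ρ(ρ−1)) = Z(Y)/Y² − Z(x)/x² + 2∫_x^Y Z(t) t⁻³ dt` (as a `HasSum`).
[cite: RosserSchoenfeld1962, Lemma 7 (proof)] -/
theorem hasSum_tailZeroTerm_sub {x Y : ℝ} (hx : 1 ≤ x) (hxY : x ≤ Y) :
    HasSum (fun ρ : Zeros ↦ tailZeroTerm ρ Y - tailZeroTerm ρ x)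
      (Zsum Y / (Y : ℂ) ^ 2 - Zsum x / (x : ℂ) ^ 2 + 2 * ∫ t in x..Y, Zsum t / (t : ℂ) ^ 3) := by
  have hx0 : 0 < x := by linarith
  have hY : 1 ≤ Y := hx.trans hxY
  have hA : HasSum (fun ρ : Zeros ↦ zeroTerm ρ Y / (Y : ℂ) ^ 2) (Zsum Y / (Y : ℂ) ^ 2) :=
    (summable_zeroTerm hY).hasSum.div_const _
  have hB : HasSum (fun ρ : Zeros ↦ zeroTerm ρ x / (x : ℂ) ^ 2) (Zsum x / (x : ℂ) ^ 2) :=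
    (summable_zeroTerm hx).hasSum.div_const _
  obtain ⟨h1, h2⟩ := integral_Zsum_div_cube hx hxY
  have hC : HasSum (fun ρ : Zeros ↦ ∫ t in x..Y, zeroTerm ρ t / (t : ℂ) ^ 3)
      (∫ t in x..Y, Zsum t / (t : ℂ) ^ 3) := by
    rw [h1]; exact h2.hasSum
  have h := (hA.sub hB).add (hC.mul_left 2)
  refine h.congr_fun fun ρ ↦ ?_
  exact (zero_bracket hx0 hxY ρ).symm


/-! ### Two elementary integrals -/

/-- `∫_x^Y t⁻³ dt = (x⁻² − Y⁻²)/2` (`0 < x ≤ Y`). [folklore] -/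
theorem integral_one_div_cube {x Y : ℝ} (hx : 0 < x) (hxY : x ≤ Y) :
    ∫ t in x..Y, 1 / t ^ 3 = (1 / x ^ 2 - 1 / Y ^ 2) / 2 := by
  have hderiv : ∀ t ∈ uIcc x Y, HasDerivAt (fun u : ℝ ↦ -(u ^ 2)⁻¹ / 2) (1 / t ^ 3) t := by
    intro t ht
    rw [uIcc_of_le hxY] at ht
    have ht0 : t ≠ 0 := by linarith [ht.1]
    have hd : HasDerivAt (fun u : ℝ ↦ (u ^ 2)⁻¹) (-2 / t ^ 3) t := by
      refine ((hasDerivAt_pow 2 t).inv (pow_ne_zero 2 ht0)).congr_deriv ?_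
      rw [div_eq_div_iff (pow_ne_zero 2 (pow_ne_zero 2 ht0)) (pow_ne_zero 3 ht0)]
      push_cast
      ring
    refine ((hd.neg).div_const 2).congr_deriv ?_
    field_simp
  have hcont : ContinuousOn (fun t : ℝ ↦ 1 / t ^ 3) (uIcc x Y) := by
    rw [uIcc_of_le hxY]
    exact continuousOn_const.div (continuousOn_pow 3) fun t ht ↦ pow_ne_zero _ (by linarith [ht.1])
  rw [integral_eq_sub_of_hasDerivAt hderiv hcont.intervalIntegrable]
  field_simp
  ring

/-- `∫_x^Y t⁻² dt = 1/x − 1/Y` (`0 < x ≤ Y`). [folklore] -/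
theorem integral_one_div_sq {x Y : ℝ} (hx : 0 < x) (hxY : x ≤ Y) :
    ∫ t in x..Y, 1 / t ^ 2 = 1 / x - 1 / Y := by
  have hderiv : ∀ t ∈ uIcc x Y, HasDerivAt (fun u : ℝ ↦ -u⁻¹) (1 / t ^ 2) t := by
    intro t ht
    rw [uIcc_of_le hxY] at ht
    have ht0 : t ≠ 0 := by linarith [ht.1]
    have h := (hasDerivAt_inv ht0).neg
    refine h.congr_deriv ?_
    field_simp
  have hcont : ContinuousOn (fun t : ℝ ↦ 1 / t ^ 2) (uIcc x Y) := by
    rw [uIcc_of_le hxY]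
    exact continuousOn_const.div (continuousOn_pow 2) fun t ht ↦ pow_ne_zero _ (by linarith [ht.1])
  rw [integral_eq_sub_of_hasDerivAt hderiv hcont.intervalIntegrable]
  field_simp
  ring

/-! ### The trivial zeros' part `e(x, Y)` -/

/-- The trivial zeros' (and constant's) part of Lemma 7 for finite `Y`:
`e(x, Y) = Re E(Y)/Y² − Re E(x)/x² + 2∫_x^Y Re E(t) t⁻³ dt`, `E` the remainder of the explicit
formula for `ψ₁`. [cite: RosserSchoenfeld1962, Lemma 7 (proof)] -/
def eRem (x Y : ℝ) : ℝ :=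
  (psiOneRemainder Y).re / Y ^ 2 - (psiOneRemainder x).re / x ^ 2 +
    2 * ∫ t in x..Y, (psiOneRemainder t).re / t ^ 3

/-- `Re E(t)/t³` is continuous on `[x, Y]`, `x ≥ 1`. [folklore] -/
theorem continuousOn_re_psiOneRemainder_div_cube {x Y : ℝ} (hx : 1 ≤ x) :
    ContinuousOn (fun t : ℝ ↦ (psiOneRemainder t).re / t ^ 3) (Icc x Y) := by
  have h1 : ContinuousOn (fun t : ℝ ↦ (psiOneRemainder t).re) (Icc x Y) :=
    (Complex.continuous_re.comp_continuousOn continuousOn_psiOneRemainder).mono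
      fun t ht ↦ hx.trans ht.1
  exact h1.div (continuousOn_pow 3) fun t ht ↦ pow_ne_zero _ (by linarith [ht.1])

/-- **`0 ≤ e(x, Y)`** for `1 < x ≤ Y` (`Re E` is non-decreasing). [cite: RosserSchoenfeld1962, Lemma 7] -/
theorem eRem_nonneg {x Y : ℝ} (hx : 1 < x) (hxY : x ≤ Y) : 0 ≤ eRem x Y := by
  have hx0 : 0 < x := by linarith
  have hY0 : 0 < Y := hx0.trans_le hxY
  set a : ℝ := (psiOneRemainder x).re with ha
  have hint : IntervalIntegrable (fun t : ℝ ↦ (psiOneRemainder t).re / t ^ 3) volume x Y := by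
    refine ContinuousOn.intervalIntegrable ?_
    rw [uIcc_of_le hxY]
    exact continuousOn_re_psiOneRemainder_div_cube hx.le
  have hint' : IntervalIntegrable (fun t : ℝ ↦ a * (1 / t ^ 3)) volume x Y := by
    refine ContinuousOn.intervalIntegrable ?_
    rw [uIcc_of_le hxY]
    exact continuousOn_const.mul (continuousOn_const.div (continuousOn_pow 3)
      fun t ht ↦ pow_ne_zero _ (by linarith [ht.1]))
  have hmono : ∫ t in x..Y, a * (1 / t ^ 3) ≤ ∫ t in x..Y, (psiOneRemainder t).re / t ^ 3 := by
    refine intervalIntegral.integral_mono_on hxY hint' hint fun t ht ↦ ?_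
    have ht0 : 0 < t ^ 3 := pow_pos (hx0.trans_le ht.1) 3
    have h1 := (re_psiOneRemainder_sub_mem hx ht.1).1
    rw [mul_one_div]
    exact div_le_div_of_nonneg_right (by linarith) ht0.le
  rw [intervalIntegral.integral_const_mul, integral_one_div_cube hx0 hxY] at hmono
  have hYx := (re_psiOneRemainder_sub_mem hx hxY).1
  rw [eRem]
  have hkey : ((psiOneRemainder Y).re - a) / Y ^ 2 ≤
      (psiOneRemainder Y).re / Y ^ 2 - a / x ^ 2 + 2 * (a * ((1 / x ^ 2 - 1 / Y ^ 2) / 2)) := by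
    have : ((psiOneRemainder Y).re - a) / Y ^ 2 =
        (psiOneRemainder Y).re / Y ^ 2 - a / x ^ 2 + 2 * (a * ((1 / x ^ 2 - 1 / Y ^ 2) / 2)) := by
      field_simp
      ring
    rw [this]
  have h0 : 0 ≤ ((psiOneRemainder Y).re - a) / Y ^ 2 := div_nonneg (by linarith) (sq_nonneg Y)
  linarith

/-- **`e(x, Y) ≤ 1/(2x(x² − 1))`** for `1 < x ≤ Y` (`0 ≤ Re E(t) − Re E(x) ≤ x/(2(x² − 1))`).
[cite: RosserSchoenfeld1962, Lemma 7] -/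
theorem eRem_le {x Y : ℝ} (hx : 1 < x) (hxY : x ≤ Y) : eRem x Y ≤ 1 / (2 * x * (x ^ 2 - 1)) := by
  have hx0 : 0 < x := by linarith
  have hY0 : 0 < Y := hx0.trans_le hxY
  have hx21 : 0 < x ^ 2 - 1 := by nlinarith
  set a : ℝ := (psiOneRemainder x).re with ha
  set c : ℝ := x / (2 * (x ^ 2 - 1)) with hc
  have hc0 : 0 ≤ c := div_nonneg hx0.le (by positivity)
  have hint : IntervalIntegrable (fun t : ℝ ↦ (psiOneRemainder t).re / t ^ 3) volume x Y := by
    refine ContinuousOn.intervalIntegrable ?_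
    rw [uIcc_of_le hxY]
    exact continuousOn_re_psiOneRemainder_div_cube hx.le
  have hint' : IntervalIntegrable (fun t : ℝ ↦ (a + c) * (1 / t ^ 3)) volume x Y := by
    refine ContinuousOn.intervalIntegrable ?_
    rw [uIcc_of_le hxY]
    exact continuousOn_const.mul (continuousOn_const.div (continuousOn_pow 3)
      fun t ht ↦ pow_ne_zero _ (by linarith [ht.1]))
  have hmono : ∫ t in x..Y, (psiOneRemainder t).re / t ^ 3 ≤ ∫ t in x..Y, (a + c) * (1 / t ^ 3) := by
    refine intervalIntegral.integral_mono_on hxY hint hint' fun t ht ↦ ?_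
    have ht0 : 0 < t ^ 3 := pow_pos (hx0.trans_le ht.1) 3
    have h1 := (re_psiOneRemainder_sub_mem hx ht.1).2
    rw [mul_one_div]
    exact div_le_div_of_nonneg_right (by linarith) ht0.le
  rw [intervalIntegral.integral_const_mul, integral_one_div_cube hx0 hxY] at hmono
  have hYx := (re_psiOneRemainder_sub_mem hx hxY).2
  rw [eRem]
  have hkey : (psiOneRemainder Y).re / Y ^ 2 - a / x ^ 2 + 2 * ((a + c) * ((1 / x ^ 2 - 1 / Y ^ 2) / 2))
      = ((psiOneRemainder Y).re - a - c) / Y ^ 2 + c / x ^ 2 := by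
    field_simp
    ring
  have h0 : ((psiOneRemainder Y).re - a - c) / Y ^ 2 ≤ 0 :=
    div_nonpos_of_nonpos_of_nonneg (by linarith) (sq_nonneg Y)
  have hcx : c / x ^ 2 = 1 / (2 * x * (x ^ 2 - 1)) := by
    rw [hc]
    field_simp
  linarith

/-! ### Lemma 7 for finite `Y` -/

/-- `(Z(t)).re / t³ = Re(Z(t)/t³)` and the like: real part of a quotient by a real number.
[folklore] -/
theorem re_div_pow (z : ℂ) (t : ℝ) (n : ℕ) : (z / (t : ℂ) ^ n).re = z.re / t ^ n := by
  rw [show ((t : ℂ) ^ n) = ((t ^ n : ℝ) : ℂ) by push_cast; rfl, Complex.div_ofReal_re]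

/-- `Re Z(t)/t³` is continuous on `[x, Y]`, `x ≥ 1`. [folklore] -/
theorem continuousOn_re_Zsum_div_cube {x Y : ℝ} (hx : 1 ≤ x) :
    ContinuousOn (fun t : ℝ ↦ (Zsum t).re / t ^ 3) (Icc x Y) := by
  have h1 : ContinuousOn (fun t : ℝ ↦ (Zsum t).re) (Icc x Y) :=
    (Complex.continuous_re.comp_continuousOn continuousOn_Zsum).mono fun t ht ↦ hx.trans ht.1
  exact h1.div (continuousOn_pow 3) fun t ht ↦ pow_ne_zero _ (by linarith [ht.1])

/-- `∫_x^Y Re Z(t) t⁻³ dt = Re ∫_x^Y Z(t) t⁻³ dt` (`1 ≤ x ≤ Y`). [folklore] -/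
theorem integral_re_Zsum_div_cube {x Y : ℝ} (hx : 1 ≤ x) (hxY : x ≤ Y) :
    ∫ t in x..Y, (Zsum t).re / t ^ 3 = (∫ t in x..Y, Zsum t / (t : ℂ) ^ 3).re := by
  have hx0 : 0 < x := by linarith
  have hint : IntervalIntegrable (fun t : ℝ ↦ Zsum t / (t : ℂ) ^ 3) volume x Y := by
    refine ContinuousOn.intervalIntegrable ?_
    rw [uIcc_of_le hxY]
    refine (continuousOn_Zsum.mono fun t ht ↦ hx.trans ht.1).div (Continuous.continuousOn (by fun_prop))
      fun t ht ↦ pow_ne_zero _ (Complex.ofReal_ne_zero.2 (by linarith [ht.1]))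
  have h := Complex.reCLM.intervalIntegral_comp_comm hint
  simp only [Complex.reCLM_apply] at h
  rw [← h]
  exact integral_congr fun t _ ↦ (re_div_pow _ _ _).symm

/-- **Rosser–Schoenfeld's Lemma 7 for finite `Y`**: for `1 < x ≤ Y`,
`∫_x^Y (ψ(t) − t) t⁻² dt = −Re ∑_ρ m(ρ)(Y^{ρ−1} − x^{ρ−1})/(ρ(ρ−1)) − log(2π)(1/x − 1/Y) + e(x, Y)`.
[cite: RosserSchoenfeld1962, Lemma 7 (proof)] -/
theorem integral_psi_sub_self_div_sq_eq {x Y : ℝ} (hx : 1 < x) (hxY : x ≤ Y) :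
    ∫ t in x..Y, (ψ t - t) / t ^ 2 =
      -(∑' ρ : Zeros, (tailZeroTerm ρ Y - tailZeroTerm ρ x)).re
        - Real.log (2 * π) * (1 / x - 1 / Y) + eRem x Y := by
  have hx0 : 0 < x := by linarith
  have hY : 1 ≤ Y := hx.le.trans hxY
  have hY0 : 0 < Y := hx0.trans_le hxY
  set L : ℝ := Real.log (2 * π) with hL
  -- the three pieces of `∫ R₁/t³`
  have hI1 : IntervalIntegrable (fun t : ℝ ↦ (Zsum t).re / t ^ 3) volume x Y := by
    refine ContinuousOn.intervalIntegrable ?_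
    rw [uIcc_of_le hxY]; exact continuousOn_re_Zsum_div_cube hx.le
  have hI2 : IntervalIntegrable (fun t : ℝ ↦ L * (1 / t ^ 2)) volume x Y := by
    refine ContinuousOn.intervalIntegrable ?_
    rw [uIcc_of_le hxY]
    exact continuousOn_const.mul (continuousOn_const.div (continuousOn_pow 2)
      fun t ht ↦ pow_ne_zero _ (by linarith [ht.1]))
  have hI3 : IntervalIntegrable (fun t : ℝ ↦ (psiOneRemainder t).re / t ^ 3) volume x Y := by
    refine ContinuousOn.intervalIntegrable ?_
    rw [uIcc_of_le hxY]; exact continuousOn_re_psiOneRemainder_div_cube hx.le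
  have hI1' : IntervalIntegrable (fun t : ℝ ↦ -((Zsum t).re / t ^ 3)) volume x Y := hI1.neg
  have hfun : EqOn (fun t : ℝ ↦ Rone t / t ^ 3)
      (fun t : ℝ ↦ (-((Zsum t).re / t ^ 3) - L * (1 / t ^ 2)) + (psiOneRemainder t).re / t ^ 3)
      (uIcc x Y) := by
    intro t ht
    rw [uIcc_of_le hxY] at ht
    have ht0 : t ≠ 0 := by linarith [ht.1]
    simp only
    rw [Rone_eq_re (hx.le.trans ht.1)]
    field_simp
    ring
  have hR : ∫ t in x..Y, Rone t / t ^ 3 =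
      -(∫ t in x..Y, (Zsum t).re / t ^ 3) - (∫ t in x..Y, L * (1 / t ^ 2)) +
        ∫ t in x..Y, (psiOneRemainder t).re / t ^ 3 := by
    rw [integral_congr hfun, intervalIntegral.integral_add (hI1'.sub hI2) hI3,
      intervalIntegral.integral_sub hI1' hI2, intervalIntegral.integral_neg]
  rw [integral_psi_sub_self_div_sq_Icc hx hxY, hR, intervalIntegral.integral_const_mul,
    integral_one_div_sq hx0 hxY, integral_re_Zsum_div_cube hx.le hxY,
    (hasSum_tailZeroTerm_sub hx.le hxY).tsum_eq, Rone_eq_re hY, Rone_eq_re hx.le, eRem]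
  simp only [Complex.add_re, Complex.sub_re, Complex.mul_re, re_div_pow, Complex.re_ofNat,
    Complex.im_ofNat]
  field_simp
  ring

/-! ### The limit `Y → ∞` -/

/-- **`∑_ρ m(ρ) Y^{ρ−1}/(ρ(ρ−1)) → 0` as `Y → ∞`** (each term tends to `0` since `β < 1`;
dominated by `∑_ρ m(ρ)/(|ρ||ρ−1|)`). [folklore] -/
theorem tendsto_tsum_tailZeroTerm :
    Tendsto (fun Y : ℝ ↦ ∑' ρ : Zeros, tailZeroTerm ρ Y) atTop (𝓝 0) := by
  have h := tendsto_tsum_of_dominated_convergence (𝓕 := atTop)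
    (f := fun (Y : ℝ) (ρ : Zeros) ↦ tailZeroTerm ρ Y) (g := fun _ ↦ (0 : ℂ))
    (bound := fun ρ ↦ (riemannZetaZeroOrder (ρ : ℂ) : ℝ) / (‖(ρ : ℂ)‖ * ‖(ρ : ℂ) - 1‖))
    summable_zeroOrder_div_norm_mul_norm_sub_one ?_ ?_
  · simpa using h
  · intro ρ
    rw [tendsto_zero_iff_norm_tendsto_zero]
    have hβ : 0 < 1 - (ρ : ℂ).re := by linarith [re_lt_one ρ.2]
    have hlim := (tendsto_rpow_neg_atTop hβ).mul_const
      ((riemannZetaZeroOrder (ρ : ℂ) : ℝ) / (‖(ρ : ℂ)‖ * ‖(ρ : ℂ) - 1‖))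
    rw [zero_mul] at hlim
    refine hlim.congr' ?_
    filter_upwards [eventually_gt_atTop 0] with Y hY
    rw [norm_tailZeroTerm hY, show (-(1 - (ρ : ℂ).re)) = (ρ : ℂ).re - 1 by ring]
    ring
  · filter_upwards [eventually_ge_atTop 1] with Y hY
    exact fun ρ ↦ norm_tailZeroTerm_le hY ρ

/-- The limit `e(x) = lim_{Y→∞} e(x, Y)`, written in closed form through the absolutely convergent
tail integral: `e(x) = ∫_x^∞ (ψ(t) − t) t⁻² dt − Re ∑_ρ m(ρ) x^{ρ−1}/(ρ(ρ−1)) + log(2π)/x`.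
[cite: RosserSchoenfeld1962, Lemma 7] -/
def eInf (x : ℝ) : ℝ :=
  (∫ t in Ioi x, (ψ t - t) / t ^ 2) - (∑' ρ : Zeros, tailZeroTerm ρ x).re + Real.log (2 * π) / x

/-- `e(x, Y) → e(x)` as `Y → ∞` (`x > 1`). [folklore] -/
theorem tendsto_eRem {x : ℝ} (hx : 1 < x) : Tendsto (fun Y : ℝ ↦ eRem x Y) atTop (𝓝 (eInf x)) := by
  set L : ℝ := Real.log (2 * π) with hL
  -- the pieces
  have hint : IntegrableOn (fun t : ℝ ↦ (ψ t - t) / t ^ 2) (Ioi x) :=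
    RosserSchoenfeld.integrableOn_psi_sub_self_div_sq.mono_set (Ioi_subset_Ioi hx.le)
  have h1 := intervalIntegral_tendsto_integral_Ioi x hint tendsto_id
  have h2 : Tendsto (fun Y : ℝ ↦ (∑' ρ : Zeros, tailZeroTerm ρ Y).re) atTop (𝓝 0) := by
    have h := (Complex.continuous_re.tendsto 0).comp tendsto_tsum_tailZeroTerm
    rw [Complex.zero_re] at h
    exact h
  have h3 : Tendsto (fun Y : ℝ ↦ L * Y⁻¹) atTop (𝓝 0) := by
    simpa using tendsto_inv_atTop_zero.const_mul L
  have hlim := ((h1.add h2).sub (tendsto_const_nhds (x := (∑' ρ : Zeros, tailZeroTerm ρ x).re))).add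
    ((tendsto_const_nhds (x := L / x)).sub h3)
  have heq : (∫ t in Ioi x, (ψ t - t) / t ^ 2) + 0 - (∑' ρ : Zeros, tailZeroTerm ρ x).re + (L / x - 0)
      = eInf x := by rw [eInf]; ring
  rw [heq] at hlim
  refine hlim.congr' ?_
  filter_upwards [eventually_ge_atTop x] with Y hY
  have hY1 : 1 ≤ Y := hx.le.trans hY
  have h := integral_psi_sub_self_div_sq_eq hx hY
  rw [(summable_tailZeroTerm hY1).tsum_sub (summable_tailZeroTerm hx.le), Complex.sub_re, ← hL] at h
  simp only [id]
  rw [h]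
  field_simp
  ring

/-- **`0 ≤ e(x)`** (`x > 1`). [cite: RosserSchoenfeld1962, Lemma 7] -/
theorem eInf_nonneg {x : ℝ} (hx : 1 < x) : 0 ≤ eInf x :=
  ge_of_tendsto (tendsto_eRem hx) (by
    filter_upwards [eventually_ge_atTop x] with Y hY
    exact eRem_nonneg hx hY)

/-- **`e(x) ≤ 1/(2x(x² − 1))`** (`x > 1`). [cite: RosserSchoenfeld1962, Lemma 7] -/
theorem eInf_le {x : ℝ} (hx : 1 < x) : eInf x ≤ 1 / (2 * x * (x ^ 2 - 1)) :=
  le_of_tendsto (tendsto_eRem hx) (by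
    filter_upwards [eventually_ge_atTop x] with Y hY
    exact eRem_le hx hY)

/-- **Rosser–Schoenfeld 1962, Lemma 7 (exact form).** For `x > 1`,
`∫_x^∞ (ψ(t) − t) t⁻² dt = Re ∑_ρ m(ρ) x^{ρ−1}/(ρ(ρ−1)) − log(2π)/x + e(x)` with
`0 ≤ e(x) ≤ 1/(2x(x² − 1))` (`eInf_nonneg`, `eInf_le`), the sum over the non-trivial zeros of `ζ`
(with multiplicity) converging absolutely. [cite: RosserSchoenfeld1962, Lemma 7] -/
theorem integral_Ioi_psi_sub_self_div_sq_eq {x : ℝ} (hx : 1 < x) :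
    ∫ t in Ioi x, (ψ t - t) / t ^ 2 =
      (∑' ρ : Zeros, tailZeroTerm ρ x).re - Real.log (2 * π) / x + eInf x := by
  have _ := hx
  rw [eInf]; ring

/-- **Lemma 7, lower form**: `−∫_x^∞ (ψ(t) − t) t⁻² dt ≤ K(x) + log(2π)/x` for `x > 1`.
[cite: RosserSchoenfeld1962, Lemma 7] -/
theorem neg_integral_Ioi_psi_sub_self_div_sq_le {x : ℝ} (hx : 1 < x) :
    -(∫ t in Ioi x, (ψ t - t) / t ^ 2) ≤ rsK x + Real.log (2 * π) / x := by
  rw [integral_Ioi_psi_sub_self_div_sq_eq hx]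
  have h1 := abs_re_tsum_tailZeroTerm_le hx.le
  have h2 := eInf_nonneg hx
  have h3 := neg_abs_le (∑' ρ : Zeros, tailZeroTerm ρ x).re
  linarith

/-- **Lemma 7, upper form**: `∫_x^∞ (ψ(t) − t) t⁻² dt ≤ K(x) − log(2π)/x + 1/(2x(x² − 1))` for
`x > 1`. [cite: RosserSchoenfeld1962, Lemma 7] -/
theorem integral_Ioi_psi_sub_self_div_sq_le {x : ℝ} (hx : 1 < x) :
    ∫ t in Ioi x, (ψ t - t) / t ^ 2 ≤ rsK x - Real.log (2 * π) / x + 1 / (2 * x * (x ^ 2 - 1)) := by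
  rw [integral_Ioi_psi_sub_self_div_sq_eq hx]
  have h1 := abs_re_tsum_tailZeroTerm_le hx.le
  have h2 := eInf_le hx
  have h3 := le_abs_self (∑' ρ : Zeros, tailZeroTerm ρ x).re
  linarith

/-- **Rosser–Schoenfeld 1962, Lemma 7** in the printed shape: for `x > 1`,
`|∫_x^∞ (ψ(t) − t) t⁻² dt| ≤ K(x) + log(2π)/x + 1/(2x(x² − 1))` (RS62 write the last two terms as
`1.84/x`; `log 2π = 1.8378…`). [cite: RosserSchoenfeld1962, Lemma 7] -/
theorem abs_integral_Ioi_psi_sub_self_div_sq_le {x : ℝ} (hx : 1 < x) :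
    |∫ t in Ioi x, (ψ t - t) / t ^ 2| ≤ rsK x + Real.log (2 * π) / x + 1 / (2 * x * (x ^ 2 - 1)) := by
  have hx0 : 0 < x := by linarith
  have hx21 : 0 < x ^ 2 - 1 := by nlinarith
  have hL : 0 ≤ Real.log (2 * π) / x := div_nonneg (Real.log_nonneg (by linarith [Real.pi_gt_three])) hx0.le
  have hE : 0 ≤ 1 / (2 * x * (x ^ 2 - 1)) := by positivity
  rw [abs_le]
  constructor
  · linarith [neg_integral_Ioi_psi_sub_self_div_sq_le hx]
  · linarith [integral_Ioi_psi_sub_self_div_sq_le hx]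


/-! ### `K(x)` under the Riemann hypothesis up to height `T` -/

/-- The tail `∑_{|Im ρ| > T} m(ρ)/(|ρ||ρ−1|)` of `∑_ρ m(ρ)/(|ρ||ρ−1|)` above height `T`.
[cite: RosserSchoenfeld1962, Lemma 7 and (6.1)] -/
def tailInvNormProd (T : ℝ) : ℝ :=
  ∑' ρ : Zeros, if ρ ∈ zerosUpTo T then 0 else
    (riemannZetaZeroOrder (ρ : ℂ) : ℝ) / (‖(ρ : ℂ)‖ * ‖(ρ : ℂ) - 1‖)

/-- The tail series converges. [folklore] -/
theorem summable_tailInvNormProd (T : ℝ) :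
    Summable fun ρ : Zeros ↦ if ρ ∈ zerosUpTo T then (0 : ℝ) else
      (riemannZetaZeroOrder (ρ : ℂ) : ℝ) / (‖(ρ : ℂ)‖ * ‖(ρ : ℂ) - 1‖) := by
  refine Summable.of_nonneg_of_le (fun ρ ↦ ?_) (fun ρ ↦ ?_) summable_zeroOrder_div_norm_mul_norm_sub_one
  · split_ifs
    · exact le_rfl
    · exact div_nonneg (zeroOrder_nonneg' ρ) (mul_nonneg (norm_nonneg _) (norm_nonneg _))
  · split_ifs
    · exact div_nonneg (zeroOrder_nonneg' ρ) (mul_nonneg (norm_nonneg _) (norm_nonneg _))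
    · exact le_rfl

/-- `tailInvNormProd T ≥ 0`. [folklore] -/
theorem tailInvNormProd_nonneg (T : ℝ) : 0 ≤ tailInvNormProd T := by
  refine tsum_nonneg fun ρ ↦ ?_
  split_ifs
  · exact le_rfl
  · exact div_nonneg (zeroOrder_nonneg' ρ) (mul_nonneg (norm_nonneg _) (norm_nonneg _))

/-- On the critical line, `‖ρ − 1‖ = ‖ρ‖`. [folklore] -/
theorem norm_sub_one_eq_norm_of_re_eq_half {ρ : ℂ} (h : ρ.re = 1 / 2) : ‖ρ - 1‖ = ‖ρ‖ := by
  have h2 : ‖ρ - 1‖ ^ 2 = ‖ρ‖ ^ 2 := by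
    rw [Complex.sq_norm, Complex.sq_norm, Complex.normSq_apply, Complex.normSq_apply]
    simp only [sub_re, one_re, sub_im, one_im, sub_zero, h]
    norm_num
  exact (pow_left_inj₀ (norm_nonneg _) (norm_nonneg _) two_ne_zero).1 h2

/-- Under RH up to height `T`, a non-trivial zero with `|Im ρ| ≤ T` has `Re ρ = 1/2`. [folklore] -/
theorem re_eq_half_of_inStripUpTo {T : ℝ} (hT : RiemannHypothesisInStripUpTo T) {ρ : Zeros}
    (hρ : ρ ∈ zerosUpTo T) : (ρ : ℂ).re = 1 / 2 :=
  hT _ (ZetaZeros.riemannZetaNontrivialZeros.zeta_eq_zero ρ.2) (re_pos ρ.2) (re_lt_one ρ.2)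
    (mem_zerosUpTo.1 hρ)

/-- **`K(x)` under RH up to height `T`**: for `x ≥ 1`,
`K(x) ≤ x^{−1/2} · ∑_{|Im ρ| ≤ T} m(ρ)/|ρ|² + ∑_{|Im ρ| > T} m(ρ)/(|ρ||ρ−1|)`: the zeros of height
`≤ T` lie on the critical line (`x^{β−1} = x^{−1/2}`, `|ρ − 1| = |ρ|`), the others have `x^{β−1} ≤ 1`.
[cite: RosserSchoenfeld1962, Lemma 7 with Lemma 6 (8.1)–(8.2)] -/
theorem rsK_le_of_inStripUpTo {T x : ℝ} (hT : RiemannHypothesisInStripUpTo T) (hx : 1 ≤ x) :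
    rsK x ≤ x ^ (-(1 / 2 : ℝ)) * sumInvNormSq T + tailInvNormProd T := by
  classical
  have hx0 : 0 < x := by linarith
  set g₁ : Zeros → ℝ := fun ρ ↦ if ρ ∈ zerosUpTo T then
      x ^ (-(1 / 2 : ℝ)) * ((riemannZetaZeroOrder (ρ : ℂ) : ℝ) / ‖(ρ : ℂ)‖ ^ 2) else 0 with hg₁
  set g₂ : Zeros → ℝ := fun ρ ↦ if ρ ∈ zerosUpTo T then 0 else
      (riemannZetaZeroOrder (ρ : ℂ) : ℝ) / (‖(ρ : ℂ)‖ * ‖(ρ : ℂ) - 1‖) with hg₂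
  have h₁ : HasSum g₁ (x ^ (-(1 / 2 : ℝ)) * sumInvNormSq T) := by
    have h : HasSum g₁ (∑ ρ ∈ zerosUpTo T, g₁ ρ) :=
      hasSum_sum_of_ne_finset_zero (fun ρ hρ ↦ by simp only [hg₁]; rw [if_neg hρ])
    have hs : ∑ ρ ∈ zerosUpTo T, g₁ ρ = x ^ (-(1 / 2 : ℝ)) * sumInvNormSq T := by
      rw [sumInvNormSq, Finset.mul_sum]
      refine Finset.sum_congr rfl fun ρ hρ ↦ ?_
      simp only [hg₁]
      rw [if_pos hρ]
    rwa [hs] at h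
  have h₂ : HasSum g₂ (tailInvNormProd T) := (summable_tailInvNormProd T).hasSum
  have hmaj : ∀ ρ : Zeros, ‖tailZeroTerm ρ x‖ ≤ g₁ ρ + g₂ ρ := by
    intro ρ
    by_cases hρ : ρ ∈ zerosUpTo T
    · simp only [hg₁, hg₂]
      rw [if_pos hρ, if_pos hρ, add_zero, norm_tailZeroTerm hx0]
      have hre := re_eq_half_of_inStripUpTo hT hρ
      rw [norm_sub_one_eq_norm_of_re_eq_half hre, hre, show (1 / 2 - 1 : ℝ) = -(1 / 2) by norm_num]
      apply le_of_eq
      ring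
    · simp only [hg₁, hg₂]
      rw [if_neg hρ, if_neg hρ, zero_add]
      exact norm_tailZeroTerm_le hx ρ
  exact hasSum_le hmaj (summable_norm_tailZeroTerm hx).hasSum (h₁.add h₂)

end PsiTailIntegral

end Literature.NumberTheory.LFunctions

end
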